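import Literature.NumberTheory.EllipticCurves.WeierstrassPDivisionValues
import Literature.NumberTheory.EllipticCurves.EisensteinSeriesNebentypusLattice
import Mathlib.NumberTheory.ModularForms.EisensteinSeries.E2.Defs
import HarnessLib

/-!
# Rows of the lattice sum of a `℘`-division value: Lipschitz evaluation

Topic `Literature/NumberTheory/EllipticCurves`; namespace
`Literature.NumberTheory.EllipticCurves.ModularForms`.  THEOREMS ONLY (no definition, no named
fact).

For the `℘`-division value `f_v(τ) = ∑_{x ∈ ℤ²} (N²/((c_v - Nx₀)τ + (d_v - Nx₁))² - 1/(x₀τ + x₁)²)`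
(`weierstrassPDiv`) the absolutely convergent double sum is summed by ROWS `x₀ = m` (Fubini):
`f_v(τ) = ∑_{m ∈ ℤ} ρ_m(τ)` (`hasSum_rows_weierstrassPDiv`), with

  `ρ_m = N² A_m - B_m`,  `A_m = ∑_{n ∈ ℤ} ((c_v - Nm)τ + (d_v - Nn))^{-2}`,
  `B_m = ∑_{n ∈ ℤ} (mτ + n)^{-2} = e2Summand m τ` (Mathlib)

(`tsum_weierstrassPDiv_row`), and each row is evaluated by **Lipschitz's formula**
`∑_{n ∈ ℤ} (w + n)^{-2} = (-2πi)² ∑_{r ≥ 0} r e^{2πirw}` (`w ∈ ℍ`; `tsum_zpow_neg_eq_tsum_cexp`,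
from Mathlib `EisensteinSeries.qExpansion_identity`):

* `tsum_eisSummand_two_residue_of_pos` / `_of_neg` — for `c ≠ 0`,
  `∑_n (cτ + d - Nn)^{-2} = N^{-2} (-2πi)² ∑_r r e^{2πi r w}`, `w = (|c|τ ± d)/N ∈ ℍ`;
* `e2Summand_of_pos` — `B_m = (-2πi)² ∑_r r e^{2πirmτ}` for `m > 0` (`B_{-m} = B_m`,
  `B_0 = 2ζ(2)`: Mathlib `e2Summand_even`, `e2Summand_zero_eq_two_riemannZeta_two`).

This is the row computation behind the Fourier expansion of `℘(u; τ)` at division points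
(Diamond–Shurman §4.6, eq. (4.22)–(4.25)); only individual absolutely convergent rows are used,
never a conditionally convergent rearrangement.

## References

* F. Diamond, J. Shurman, *A First Course in Modular Forms*, GTM 228 (2005), §1.5, §4.6.
  [DiamondShurman2005]
-/

noncomputable section

open UpperHalfPlane EisensteinSeries Complex Filter

open scoped Real MatrixGroups

namespace Literature.NumberTheory.EllipticCurves.ModularForms

variable {N : ℕ} [NeZero N]

/-! ### Fubini: `f_v = ∑_m ρ_m` -/

omit [NeZero N] in
/-- The lattice-sum summand of `f_v` at `x = (m, n)`. [folklore] -/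
theorem weierstrassPDiv_summand_vecTwo (v : Fin 2 → ℤ) (τ : ℍ) (m n : ℤ) :
    (N : ℂ) ^ 2 * eisSummand 2 (v - (N : ℤ) • ![m, n]) τ - eisSummand 2 ![m, n] τ =
      (N : ℂ) ^ 2 * eisSummand 2 ![v 0 - N * m, v 1 - N * n] τ - eisSummand 2 ![m, n] τ := by
  congr 3
  funext i
  fin_cases i <;> simp

/-- The lattice sum of `f_v`, as a family on `ℤ × ℤ`, is summable. [folklore] -/
theorem summable_weierstrassPDiv_prod (v : Fin 2 → ℤ) (τ : ℍ) :
    Summable fun p : ℤ × ℤ ↦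
      (N : ℂ) ^ 2 * eisSummand 2 ![v 0 - N * p.1, v 1 - N * p.2] τ - eisSummand 2 ![p.1, p.2] τ := by
  have h0 : Summable fun x : Fin 2 → ℤ ↦
      (N : ℂ) ^ 2 * eisSummand 2 (v - (N : ℤ) • x) τ - eisSummand 2 x τ :=
    summable_weierstrassPDiv (NeZero.ne N) v τ
  have h := (finTwoArrowEquiv ℤ).symm.summable_iff.mpr h0
  refine h.congr fun p ↦ ?_
  rw [Function.comp_apply, finTwoArrowEquiv_symm_apply, weierstrassPDiv_summand_vecTwo]

/-- The row `n ↦ N² e₂(v - N(m,n)) - e₂(m,n)` of the lattice sum of `f_v` is summable.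
[folklore] -/
theorem summable_weierstrassPDiv_row (v : Fin 2 → ℤ) (τ : ℍ) (m : ℤ) :
    Summable fun n : ℤ ↦
      (N : ℂ) ^ 2 * eisSummand 2 ![v 0 - N * m, v 1 - N * n] τ - eisSummand 2 ![m, n] τ :=
  (summable_weierstrassPDiv_prod (N := N) v τ).prod_factor m

/-- **`f_v(τ) = ∑_{m ∈ ℤ} ρ_m(τ)`**, `ρ_m = ∑_n (N² e₂(v - N(m,n)) - e₂(m,n))` (Fubini for the
absolutely convergent lattice sum, summed by rows). [cite: DiamondShurman2005, §4.6] -/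
theorem hasSum_rows_weierstrassPDiv (v : Fin 2 → ℤ) (τ : ℍ) :
    HasSum (fun m : ℤ ↦ ∑' n : ℤ,
      ((N : ℂ) ^ 2 * eisSummand 2 ![v 0 - N * m, v 1 - N * n] τ - eisSummand 2 ![m, n] τ))
      (weierstrassPDiv N v τ) := by
  have h' := summable_weierstrassPDiv_prod (N := N) v τ
  have hsum : ∑' p : ℤ × ℤ,
      ((N : ℂ) ^ 2 * eisSummand 2 ![v 0 - N * p.1, v 1 - N * p.2] τ - eisSummand 2 ![p.1, p.2] τ) =
        weierstrassPDiv N v τ := by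
    unfold weierstrassPDiv
    rw [← (finTwoArrowEquiv ℤ).symm.tsum_eq]
    refine tsum_congr fun p ↦ ?_
    rw [finTwoArrowEquiv_symm_apply, weierstrassPDiv_summand_vecTwo]
  rw [← hsum, h'.tsum_prod]
  exact h'.prod.hasSum

/-! ### The two pieces `A_m`, `B_m` of a row -/

/-- The family `n ↦ ((cτ + d) - Nn)^{-2}` (a residue class of the row `(cτ + ·)^{-2}`) is summable.
[folklore] -/
theorem summable_eisSummand_two_residue (c d : ℤ) (τ : ℍ) :
    Summable fun n : ℤ ↦ eisSummand 2 ![c, d - N * n] τ := by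
  have hN : N ≠ 0 := NeZero.ne N
  have h := (linear_right_summable (τ : ℂ) c (k := 2) le_rfl).comp_injective
    (i := fun n : ℤ ↦ d - N * n) (fun a b hab ↦ by simpa [hN] using hab)
  refine h.congr fun n ↦ ?_
  simp only [Function.comp_apply, eisSummand, Matrix.cons_val_zero, Matrix.cons_val_one,
    Matrix.cons_val_fin_one, _root_.zpow_neg, zpow_ofNat]

/-- **`ρ_m = N² A_m - B_m`** with `A_m = ∑_n ((c_v - Nm)τ + (d_v - Nn))^{-2}` and
`B_m = e2Summand m τ = ∑_n (mτ + n)^{-2}`: both pieces are absolutely convergent. [folklore] -/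
theorem tsum_weierstrassPDiv_row (v : Fin 2 → ℤ) (τ : ℍ) (m : ℤ) :
    ∑' n : ℤ, ((N : ℂ) ^ 2 * eisSummand 2 ![v 0 - N * m, v 1 - N * n] τ - eisSummand 2 ![m, n] τ) =
      (N : ℂ) ^ 2 * ∑' n : ℤ, eisSummand 2 ![v 0 - N * m, v 1 - N * n] τ - e2Summand m τ := by
  rw [Summable.tsum_sub ((summable_eisSummand_two_residue _ _ τ).mul_left _)
    (e2Summand_summable m τ), tsum_mul_left, e2Summand]

/-! ### Lipschitz evaluation of the rows -/

omit [NeZero N] in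
/-- Positivity of the imaginary part of `(cτ + d)/N` for `c > 0`. [folklore] -/
theorem im_div_pos {c : ℤ} (hc : 0 < c) (d : ℤ) (τ : ℍ) (hN : 0 < N) :
    0 < (((c : ℂ) * τ + d) / N).im := by
  rw [Complex.div_natCast_im]
  simp only [Complex.add_im, Complex.mul_im, Complex.intCast_re, Complex.intCast_im, zero_mul,
    add_zero, UpperHalfPlane.coe_im, UpperHalfPlane.coe_re]
  exact div_pos (mul_pos (Int.cast_pos.mpr hc) τ.im_pos) (Nat.cast_pos.mpr hN)

/-- **The piece `A` for `c > 0`**: `∑_{n ∈ ℤ} (cτ + d - Nn)^{-2} = N^{-2} (-2πi)² ∑_{r ≥ 0} r e^{2πirw}`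
with `w = (cτ + d)/N ∈ ℍ` (substitute `n ↦ -n` and apply Lipschitz's formula).
[cite: DiamondShurman2005, §4.6 (4.22)–(4.24)] -/
theorem tsum_eisSummand_two_residue_of_pos {c : ℤ} (hc : 0 < c) (d : ℤ) (τ : ℍ) :
    ∑' n : ℤ, eisSummand 2 ![c, d - N * n] τ =
      ((N : ℂ) ^ 2)⁻¹ * (-2 * π * Complex.I) ^ 2 *
        ∑' r : ℕ, (r : ℂ) * cexp (2 * π * Complex.I * (((c : ℂ) * τ + d) / N)) ^ r := by
  have hN0 : (N : ℂ) ≠ 0 := by exact_mod_cast NeZero.ne N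
  set w : ℍ := ⟨((c : ℂ) * τ + d) / N, im_div_pos hc d τ (NeZero.pos N)⟩ with hw
  have hwc : (w : ℂ) = ((c : ℂ) * τ + d) / N := rfl
  have hL := tsum_zpow_neg_eq_tsum_cexp (k := 2) le_rfl w
  simp only [Nat.cast_ofNat, show (2 : ℕ) - 1 = 1 from rfl, Nat.factorial_one, Nat.cast_one,
    div_one, pow_one] at hL
  rw [← (Equiv.neg ℤ).tsum_eq]
  have hterm : ∀ n : ℤ, eisSummand 2 ![c, d - N * (Equiv.neg ℤ n)] τ =
      ((N : ℂ) ^ 2)⁻¹ * ((w : ℂ) + n) ^ (-2 : ℤ) := by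
    intro n
    have hbase : ((![c, d - N * (Equiv.neg ℤ n)] 0 : ℤ) : ℂ) * τ +
        ((![c, d - N * (Equiv.neg ℤ n)] 1 : ℤ) : ℂ) = (N : ℂ) * ((w : ℂ) + n) := by
      simp only [Matrix.cons_val_zero, Matrix.cons_val_one, Matrix.cons_val_fin_one,
        Equiv.neg_apply]
      rw [hwc]
      push_cast
      field_simp
      ring
    rw [eisSummand, hbase, mul_zpow, _root_.zpow_neg (N : ℂ), zpow_ofNat]
  simp_rw [hterm]
  rw [tsum_mul_left, hL, ← mul_assoc, hwc]

/-- **The piece `A` for `c < 0`**: `∑_{n ∈ ℤ} (cτ + d - Nn)^{-2} = N^{-2} (-2πi)² ∑_{r ≥ 0} r e^{2πirw}`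
with `w = ((-c)τ - d)/N ∈ ℍ` (the square is even). [cite: DiamondShurman2005, §4.6 (4.22)–(4.24)] -/
theorem tsum_eisSummand_two_residue_of_neg {c : ℤ} (hc : c < 0) (d : ℤ) (τ : ℍ) :
    ∑' n : ℤ, eisSummand 2 ![c, d - N * n] τ =
      ((N : ℂ) ^ 2)⁻¹ * (-2 * π * Complex.I) ^ 2 *
        ∑' r : ℕ, (r : ℂ) *
          cexp (2 * π * Complex.I * ((((-c : ℤ) : ℂ) * τ + ((-d : ℤ) : ℂ)) / N)) ^ r := by
  have hN0 : (N : ℂ) ≠ 0 := by exact_mod_cast NeZero.ne N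
  have hc' : 0 < -c := by omega
  set w : ℍ := ⟨((((-c : ℤ)) : ℂ) * τ + ((-d : ℤ) : ℂ)) / N, im_div_pos hc' (-d) τ (NeZero.pos N)⟩
    with hw
  have hwc : (w : ℂ) = ((((-c : ℤ)) : ℂ) * τ + ((-d : ℤ) : ℂ)) / N := rfl
  have hL := tsum_zpow_neg_eq_tsum_cexp (k := 2) le_rfl w
  simp only [Nat.cast_ofNat, show (2 : ℕ) - 1 = 1 from rfl, Nat.factorial_one, Nat.cast_one,
    div_one, pow_one] at hL
  have hterm : ∀ n : ℤ, eisSummand 2 ![c, d - N * n] τ =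
      ((N : ℂ) ^ 2)⁻¹ * ((w : ℂ) + n) ^ (-2 : ℤ) := by
    intro n
    have hbase : ((![c, d - N * n] 0 : ℤ) : ℂ) * τ + ((![c, d - N * n] 1 : ℤ) : ℂ) =
        -((N : ℂ) * ((w : ℂ) + n)) := by
      simp only [Matrix.cons_val_zero, Matrix.cons_val_one, Matrix.cons_val_fin_one]
      rw [hwc]
      push_cast
      field_simp
      ring
    rw [eisSummand, hbase, Even.neg_zpow ⟨-1, by norm_num⟩, mul_zpow, _root_.zpow_neg (N : ℂ),
      zpow_ofNat]
  simp_rw [hterm]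
  rw [tsum_mul_left, hL, ← mul_assoc, hwc]

omit [NeZero N] in
/-- **The piece `B` for `m > 0`**: `e2Summand m τ = ∑_{n ∈ ℤ} (mτ + n)^{-2} = (-2πi)² ∑_{r ≥ 0} r e^{2πirmτ}`
(Lipschitz). [cite: DiamondShurman2005, §1.1 and §4.6] -/
theorem e2Summand_of_pos {m : ℤ} (hm : 0 < m) (τ : ℍ) :
    e2Summand m τ =
      (-2 * π * Complex.I) ^ 2 * ∑' r : ℕ, (r : ℂ) * cexp (2 * π * Complex.I * ((m : ℂ) * τ)) ^ r := by
  have him : 0 < ((m : ℂ) * τ).im := by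
    simp only [Complex.mul_im, Complex.intCast_re, Complex.intCast_im, zero_mul, add_zero,
      UpperHalfPlane.coe_im]
    exact mul_pos (Int.cast_pos.mpr hm) τ.im_pos
  set w : ℍ := ⟨(m : ℂ) * τ, him⟩ with hw
  have hwc : (w : ℂ) = (m : ℂ) * τ := rfl
  have hL := tsum_zpow_neg_eq_tsum_cexp (k := 2) le_rfl w
  simp only [Nat.cast_ofNat, show (2 : ℕ) - 1 = 1 from rfl, Nat.factorial_one, Nat.cast_one,
    div_one, pow_one] at hL
  rw [e2Summand]
  have hterm : ∀ n : ℤ, eisSummand 2 ![m, n] τ = ((w : ℂ) + n) ^ (-2 : ℤ) := by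
    intro n
    rw [eisSummand, hwc]
    simp
  simp_rw [hterm]
  rw [hL, hwc]

end Literature.NumberTheory.EllipticCurves.ModularForms
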